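import Literature.AlgebraicGeometry.Resolution.HilbertSamuelLocal
import Literature.AlgebraicGeometry.Resolution.ResolutionGlue
import Literature.AlgebraicGeometry.Limits.PushoutOpenImmersion
import Mathlib.AlgebraicGeometry.Morphisms.Proper
import Mathlib.AlgebraicGeometry.Limits
import HarnessLib

/-!
# Route `HilbertSamuelElimination`, crux `SigmaMaxModificationsCorridor3`
# (stmt-ResolutionOfSingularities-19249; child of `SigmaMaxModifications` stmt-…-18506),
# line `tame_wild`: gluing toolkit for local `ν`-witnesses (public form)

[OURS · L1 W4.2] The scheme-theoretic gluing behind the `ν`-gluing of the line (`L/w42/CHAIN.md` v2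
§4 helper G2 "ν-gluing v2"; lead-1's RESHAPE v3: "shape-preserving two-chart merge + induction, then
p459350"). The landed one-chart gluing `TameWild.nuMod_of_localWitness` (p459350,
`…Corridor3TameWildNuGluing.lean`) keeps its pushout lemmas `private`; this file re-derives them in
PUBLIC and GENERALISED form (on top of the tree's `Literature.AlgebraicGeometry.Limits.PushoutOpenImmersion`)
so that two local witnesses (and, by induction, finitely many) can be merged before p459350 is
applied. NOT a statement of any manuscript.

* `exists_glue_of_isIso` — **gluing along an open where both charts are isomorphisms** (Stacks
  01JA/01LH): for opens `Z₀, U₁ ⊆ X`, `ρ : Y → U₁` an isomorphism over `U₁ ∩ Z₀`, and ANY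
  `σ : X₀ → X` that is an isomorphism over `U₁ ∩ Z₀` and satisfies `σ(X₀) ∩ U₁ ⊆ Z₀` (both
  isomorphy hypotheses stated as `IsIso (_ ∣_ (U₁ ⊓ Z₀))`), the pushout
  `X'` of `Y ↩ ρ⁻¹(U₁ ∩ Z₀) ≅ σ⁻¹(U₁ ∩ Z₀) ↪ X₀` carries `π : X' → X` with `inl ≫ π = ρ ≫ ι_{U₁}`,
  `inr ≫ π = σ`, jointly surjective open immersions `inl, inr`, `π⁻¹(U₁) ⊆ inl(Y)` and
  `inl(ρ⁻¹(U₁ ∩ Z₀)) ⊆ inr(X₀)`. (p459350's private `exists_glue` is the case `σ = ι_{Zc}`,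
  `Z₀ = Zc`; the merge of two witnesses is the case `σ = ρ₂ ≫ ι_{U₂}`, `Z₀ = U₂ ∩ Zc`.)
* chart lemmas: `isIso_ι_morphismRestrict_of_le`, `isIso_morphismRestrict_preimage_of_range` (an open immersion chart covering
  `ρ⁻¹(W)` restricts to an isomorphism over it), `isIso_morphismRestrict_of_chart`,
  `isProper_morphismRestrict_of_chart` (isomorphy / properness over `W` is read on such a chart),
  `isReduced_of_inl_inr`, `topologicalKrullDim_le_of_inl_inr`, `dense_of_inl_inr`,
  `hsFun_eq_of_isOpenImmersion_src` (reducedness, dimension, density and the Hilbert–Samuel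
  function through two jointly surjective open immersions).

## Sources

* The Stacks Project, Tags 01JA, 01LH (gluing of schemes), 02I4. [StacksProject]
* V. Cossart, U. Jannsen, S. Saito, LNM 2270 (2020), Def. 2.28, Def. 6.14, Rem. 6.24.
  [CossartJannsenSaito2020]
-/

set_option linter.dupNamespace false -- mandated namespace of this single-conjunct summit

noncomputable section

open CategoryTheory CategoryTheory.Limits AlgebraicGeometry TopologicalSpace Topology
open Literature.AlgebraicGeometry.Resolution Literature.RingTheory.HilbertSamuel

namespace Summit.ResolutionOfSingularities.ResolutionOfSingularities.Theorems.SigmaMaxModificationsCorridor3.Helpers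

universe u

/-! ## Pushouts of two open immersions (Stacks 01JA) -/

section Pushout

variable {W Y Z : Scheme.{u}} (f : W ⟶ Y) (g : W ⟶ Z) [IsOpenImmersion f] [IsOpenImmersion g]

/-- The two structure maps of the pushout of two open immersions are jointly surjective
(pointwise form of `Literature.AlgebraicGeometry.Limits.range_inl_union_range_inr`).
[cite: StacksProject, Tag 01JA] -/
theorem pushout_inl_or_inr (x : ↑(pushout f g)) :
    (∃ y : Y, pushout.inl f g y = x) ∨ (∃ z : Z, pushout.inr f g z = x) := by
  have h := Set.eq_univ_iff_forall.mp
    (Literature.AlgebraicGeometry.Limits.range_inl_union_range_inr f g) x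
  rcases h with ⟨y, hy⟩ | ⟨z, hz⟩
  · exact Or.inl ⟨y, hy⟩
  · exact Or.inr ⟨z, hz⟩

end Pushout

/-! ## Charts: open immersions covering a preimage -/

/-- An open immersion with surjective underlying map is an isomorphism. [folklore] -/
theorem isIso_of_isOpenImmersion_of_surjective {X Y : Scheme.{u}} (f : X ⟶ Y) [IsOpenImmersion f]
    (h : Function.Surjective f) : IsIso f :=
  haveI : Epi f.base := (TopCat.epi_iff_surjective _).mpr h
  IsOpenImmersion.isIso f

/-- If `j : Y₁ → Y` is an open immersion whose range contains `ρ⁻¹(W)`, then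
`j ∣_ ρ⁻¹(W) : j⁻¹ρ⁻¹(W) → ρ⁻¹(W)` is an isomorphism. [folklore] -/
theorem isIso_morphismRestrict_preimage_of_range {Y₁ Y S : Scheme.{u}} (j : Y₁ ⟶ Y)
    [IsOpenImmersion j] (ρ : Y ⟶ S) (W : S.Opens) (hr : ∀ y : Y, ρ y ∈ W → ∃ y₁, j y₁ = y) :
    IsIso (j ∣_ (ρ ⁻¹ᵁ W)) := by
  refine isIso_of_isOpenImmersion_of_surjective _ fun y => ?_
  obtain ⟨y₁, hy₁⟩ := hr y.1 y.2
  have hmem : y₁ ∈ j ⁻¹ᵁ (ρ ⁻¹ᵁ W) := by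
    show j y₁ ∈ ρ ⁻¹ᵁ W
    rw [hy₁]
    exact y.2
  refine ⟨⟨y₁, hmem⟩, Subtype.ext ?_⟩
  rw [morphismRestrict_base_coe]
  exact hy₁

/-- **Isomorphy over `W` is read on a chart:** if `j : Y₁ → Y` is an open immersion covering
`ρ⁻¹(W)` and `j ≫ ρ` is an isomorphism over `W`, so is `ρ`. [folklore] -/
theorem isIso_morphismRestrict_of_chart {Y₁ Y S : Scheme.{u}} (j : Y₁ ⟶ Y) [IsOpenImmersion j]
    (ρ : Y ⟶ S) (W : S.Opens) (hr : ∀ y : Y, ρ y ∈ W → ∃ y₁, j y₁ = y)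
    (h : IsIso ((j ≫ ρ) ∣_ W)) : IsIso (ρ ∣_ W) := by
  haveI := isIso_morphismRestrict_preimage_of_range j ρ W hr
  rw [morphismRestrict_comp] at h
  exact @IsIso.of_isIso_comp_left _ _ _ _ _ (j ∣_ ρ ⁻¹ᵁ W) (ρ ∣_ W) inferInstance h

/-- **Properness over `W` is read on a chart:** if `j : Y₁ → Y` is an open immersion covering
`ρ⁻¹(W)` and `j ≫ ρ` is proper over `W`, so is `ρ`. [folklore] -/
theorem isProper_morphismRestrict_of_chart {Y₁ Y S : Scheme.{u}} (j : Y₁ ⟶ Y) [IsOpenImmersion j]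
    (ρ : Y ⟶ S) (W : S.Opens) (hr : ∀ y : Y, ρ y ∈ W → ∃ y₁, j y₁ = y)
    (h : IsProper ((j ≫ ρ) ∣_ W)) : IsProper (ρ ∣_ W) := by
  haveI := isIso_morphismRestrict_preimage_of_range j ρ W hr
  rw [morphismRestrict_comp] at h
  have he : ρ ∣_ W = inv (j ∣_ ρ ⁻¹ᵁ W) ≫ (j ∣_ ρ ⁻¹ᵁ W ≫ ρ ∣_ W) := by
    rw [IsIso.inv_hom_id_assoc]
  rw [he]
  have h1 : IsProper (inv (j ∣_ ρ ⁻¹ᵁ W)) := MorphismProperty.of_isIso @IsProper _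
  exact MorphismProperty.comp_mem @IsProper _ _ h1 h

/-! ## Two jointly surjective open charts -/

/-- A scheme covered by two open immersions from reduced schemes is reduced. [folklore] -/
theorem isReduced_of_inl_inr {X' Y Z : Scheme.{u}} [IsReduced Y] [IsReduced Z]
    (inl : Y ⟶ X') (inr : Z ⟶ X') [IsOpenImmersion inl] [IsOpenImmersion inr]
    (h : ∀ x' : X', (∃ y, inl y = x') ∨ (∃ z, inr z = x')) : IsReduced X' := by
  have key : ∀ x' : X', _root_.IsReduced (X'.presheaf.stalk x') := by
    intro x'
    rcases h x' with ⟨y, rfl⟩ | ⟨z, rfl⟩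
    · exact isReduced_of_injective _ (asIso <| inl.stalkMap y).commRingCatIsoToRingEquiv.injective
    · exact isReduced_of_injective _ (asIso <| inr.stalkMap z).commRingCatIsoToRingEquiv.injective
  exact isReduced_of_isReduced_stalk _

/-- `dim S ≤ n` iff every point has coheight `≤ n` in the specialisation order. [folklore] -/
theorem topologicalKrullDim_le_iff_forall_coheight_le (S : Scheme.{u}) (n : ℕ) :
    topologicalKrullDim S ≤ n ↔ ∀ s : S, Order.coheight s ≤ n := by
  have h : topologicalKrullDim S = Order.krullDim S :=
    Order.krullDim_eq_of_orderIso (irreducibleSetEquivPoints (α := S))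
  rw [h, Order.krullDim_eq_iSup_coheight, iSup_le_iff]
  exact forall_congr' fun s => by exact_mod_cast Iff.rfl

/-- A scheme covered by two open immersions from schemes of dimension `≤ n` has dimension `≤ n`
(coheights are unchanged under open immersions). [cite: StacksProject, Tag 02I4] -/
theorem topologicalKrullDim_le_of_inl_inr {X' Y Z : Scheme.{u}} {n : ℕ}
    (inl : Y ⟶ X') (inr : Z ⟶ X') [IsOpenImmersion inl] [IsOpenImmersion inr]
    (h : ∀ x' : X', (∃ y, inl y = x') ∨ (∃ z, inr z = x'))
    (hY : topologicalKrullDim Y ≤ n) (hZ : topologicalKrullDim Z ≤ n) :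
    topologicalKrullDim X' ≤ n := by
  rw [topologicalKrullDim_le_iff_forall_coheight_le] at hY hZ ⊢
  intro x'
  rcases h x' with ⟨y, rfl⟩ | ⟨z, rfl⟩
  · rw [coheight_eq_of_isOpenImmersion]
    exact hY y
  · rw [coheight_eq_of_isOpenImmersion]
    exact hZ z

/-- **Density is read on two charts:** a subset whose preimages under two jointly surjective open
immersions are dense is dense. [folklore] -/
theorem dense_of_inl_inr {X' Y Z : Scheme.{u}} (inl : Y ⟶ X') (inr : Z ⟶ X')
    (h : ∀ x' : X', (∃ y, inl y = x') ∨ (∃ z, inr z = x')) (A : Set X')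
    (hY : Dense ((fun y => inl y) ⁻¹' A)) (hZ : Dense ((fun z => inr z) ⁻¹' A)) : Dense A := by
  rw [dense_iff_closure_eq, Set.eq_univ_iff_forall]
  intro x'
  rcases h x' with ⟨y, rfl⟩ | ⟨z, rfl⟩
  · have h1 : (fun y => inl y) '' closure ((fun y => inl y) ⁻¹' A) ⊆
        closure ((fun y => inl y) '' ((fun y => inl y) ⁻¹' A)) :=
      image_closure_subset_closure_image inl.continuous
    have h2 : inl y ∈ (fun y => inl y) '' closure ((fun y => inl y) ⁻¹' A) :=
      ⟨y, by rw [hY.closure_eq]; exact Set.mem_univ y, rfl⟩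
    exact closure_mono (Set.image_preimage_subset _ _) (h1 h2)
  · have h1 : (fun z => inr z) '' closure ((fun z => inr z) ⁻¹' A) ⊆
        closure ((fun z => inr z) '' ((fun z => inr z) ⁻¹' A)) :=
      image_closure_subset_closure_image inr.continuous
    have h2 : inr z ∈ (fun z => inr z) '' closure ((fun z => inr z) ⁻¹' A) :=
      ⟨z, by rw [hZ.closure_eq]; exact Set.mem_univ z, rfl⟩
    exact closure_mono (Set.image_preimage_subset _ _) (h1 h2)

/-- **Open immersions preserve the Hilbert–Samuel function** (variant of
`Scheme.hsFun_eq_of_isOpenImmersion` with the Noetherian hypothesis on the SOURCE, so that it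
applies to the charts of a glued scheme before that scheme is known to be locally Noetherian).
[cite: CossartJannsenSaito2020, Def. 2.28] -/
theorem hsFun_eq_of_isOpenImmersion_src {X Y : Scheme.{u}} (f : X ⟶ Y)
    [IsLocallyNoetherian X] [IsOpenImmersion f] (N : ℕ) (x : X) :
    Scheme.hsFun X N x = Scheme.hsFun Y N (f x) := by
  rw [Scheme.hsFun, Scheme.hsFun, Scheme.hsPhi_eq_of_isIso_stalkMap f N x]
  exact hilbertSamuelFun_eq_of_ringEquiv
    (asIso (f.stalkMap x)).commRingCatIsoToRingEquiv.symm _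

/-! ## Gluing along an open where both charts are isomorphisms -/

/-- `U.ι ∣_ W` is an isomorphism for `W ≤ U` (a surjective open immersion). [folklore] -/
theorem isIso_ι_morphismRestrict_of_le {X : Scheme.{u}} (U W : X.Opens) (h : W ≤ U) :
    IsIso (U.ι ∣_ W) := by
  refine isIso_of_isOpenImmersion_of_surjective _ fun w => ?_
  have hmem : (⟨w.1, h w.2⟩ : U) ∈ U.ι ⁻¹ᵁ W := by
    show U.ι ⟨w.1, h w.2⟩ ∈ W
    exact w.2
  refine ⟨⟨⟨w.1, h w.2⟩, hmem⟩, Subtype.ext ?_⟩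
  rw [morphismRestrict_base_coe]
  rfl

/-- **Gluing along an open (Stacks 01JA / 01LH), two-witness form.** Let `Z₀, U₁ ⊆ X` be opens,
`ρ : Y → U₁` with `ρ ≫ ι_{U₁}` an isomorphism over `U₁ ∩ Z₀`, and `σ : X₀ → X` an isomorphism over
`U₁ ∩ Z₀` with `σ(X₀) ∩ U₁ ⊆ Z₀`. The pushout `X'` of `Y ↩ ρ⁻¹(U₁ ∩ Z₀) ≅ σ⁻¹(U₁ ∩ Z₀) ↪ X₀` carries
`π : X' → X` restricting to `ρ` on the chart `Y` and to `σ` on the chart `X₀`; the structure maps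
`inl : Y → X'`, `inr : X₀ → X'` are jointly surjective open immersions, every point of `X'` over
`U₁` lies in the chart `Y`, and the points of `Y` over `Z₀` lie in the chart `X₀`.
(`σ = ι_{Zc}`: the glue of p459350; `σ = ρ₂ ≫ ι_{U₂}`: the merge of two witnesses.)
[cite: StacksProject, Tag 01LH] -/
theorem exists_glue_of_isIso {X Y X₀ : Scheme.{u}} (Z₀ U₁ : X.Opens) (ρ : Y ⟶ U₁) (σ : X₀ ⟶ X)
    [IsIso ((ρ ≫ U₁.ι) ∣_ (U₁ ⊓ Z₀))] [IsIso (σ ∣_ (U₁ ⊓ Z₀))]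
    (hσ : ∀ z : X₀, σ z ∈ U₁ → σ z ∈ Z₀) :
    ∃ (X' : Scheme.{u}) (π : X' ⟶ X) (inl : Y ⟶ X') (inr : X₀ ⟶ X'),
      IsOpenImmersion inl ∧ IsOpenImmersion inr ∧ inl ≫ π = ρ ≫ U₁.ι ∧ inr ≫ π = σ ∧
      (∀ x' : X', (∃ y, inl y = x') ∨ (∃ z, inr z = x')) ∧
      (∀ x' : X', π x' ∈ U₁ → ∃ y, inl y = x') ∧
      (∀ y : Y, U₁.ι (ρ y) ∈ Z₀ → ∃ z, inr z = inl y) := by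
  -- the isomorphism `ρ⁻¹(U₁ ∩ Z₀) ≅ σ⁻¹(U₁ ∩ Z₀)` followed by the open immersion into `X₀`
  let V : Y.Opens := (ρ ≫ U₁.ι) ⁻¹ᵁ (U₁ ⊓ Z₀)
  let φ : (V : Scheme.{u}) ⟶ ↑(σ ⁻¹ᵁ (U₁ ⊓ Z₀)) :=
    ((ρ ≫ U₁.ι) ∣_ (U₁ ⊓ Z₀)) ≫ inv (σ ∣_ (U₁ ⊓ Z₀))
  haveI hφ : IsIso φ := by
    dsimp only [φ]
    infer_instance
  have hφσ : φ ≫ (σ ∣_ (U₁ ⊓ Z₀)) = (ρ ≫ U₁.ι) ∣_ (U₁ ⊓ Z₀) := by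
    simp only [φ, Category.assoc, IsIso.inv_hom_id, Category.comp_id]
  let i₂ : (V : Scheme.{u}) ⟶ X₀ := φ ≫ (σ ⁻¹ᵁ (U₁ ⊓ Z₀)).ι
  haveI : IsOpenImmersion i₂ := by
    dsimp only [i₂]
    infer_instance
  have hi₂σ : i₂ ≫ σ = V.ι ≫ ρ ≫ U₁.ι := by
    simp only [i₂, Category.assoc]
    rw [← morphismRestrict_ι, ← Category.assoc φ, hφσ, morphismRestrict_ι]
  -- the points of `X₀` over `U₁ ∩ Z₀` are hit by `i₂`
  have hi₂range : ∀ z : X₀, σ z ∈ (U₁ ⊓ Z₀ : X.Opens) → ∃ v, i₂ v = z := by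
    intro z hz
    obtain ⟨v, hv⟩ := (Scheme.homeoOfIso (asIso φ)).surjective ⟨z, hz⟩
    refine ⟨v, ?_⟩
    show (σ ⁻¹ᵁ (U₁ ⊓ Z₀)).ι (φ v) = z
    have hv' : φ v = ⟨z, hz⟩ := hv
    rw [hv']
    rfl
  haveI := Literature.AlgebraicGeometry.Limits.isOpenImmersion_inl V.ι i₂
  haveI := Literature.AlgebraicGeometry.Limits.isOpenImmersion_inr V.ι i₂
  refine ⟨pushout V.ι i₂, pushout.desc (ρ ≫ U₁.ι) σ hi₂σ.symm,
    pushout.inl _ _, pushout.inr _ _, inferInstance, inferInstance, pushout.inl_desc _ _ _,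
    pushout.inr_desc _ _ _, pushout_inl_or_inr _ _, fun x' hx' => ?_, fun y hy => ?_⟩
  · -- a point over `U₁` lies in the chart `Y`
    rcases pushout_inl_or_inr _ i₂ x' with ⟨y, rfl⟩ | ⟨z, rfl⟩
    · exact ⟨y, rfl⟩
    · rw [← Scheme.Hom.comp_apply, pushout.inr_desc] at hx'
      obtain ⟨v, hv⟩ := hi₂range z (Opens.mem_inf.mpr ⟨hx', hσ z hx'⟩)
      exact ⟨V.ι v, by
        rw [← Scheme.Hom.comp_apply, pushout.condition, Scheme.Hom.comp_apply, hv]⟩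
  · -- a point of `Y` over `Z₀` lies in the chart `X₀`
    have hyV : y ∈ V := by
      show (ρ ≫ U₁.ι) y ∈ (U₁ ⊓ Z₀ : X.Opens)
      rw [Scheme.Hom.comp_apply]
      exact Opens.mem_inf.mpr ⟨(ρ y).2, hy⟩
    exact ⟨i₂ ⟨y, hyV⟩, by
      rw [← Scheme.Hom.comp_apply, ← pushout.condition, Scheme.Hom.comp_apply]; rfl⟩

end Summit.ResolutionOfSingularities.ResolutionOfSingularities.Theorems.SigmaMaxModificationsCorridor3.Helpers

end
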